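import Summits.ValiantsHypothesis.ValiantsHypothesis.Theorems.SymmetroidPencilBasics
import Summits.ValiantsHypothesis.ValiantsHypothesis.Theorems.LacunarySymmetroidMatrixDescartesStubReverse
import Summits.ValiantsHypothesis.ValiantsHypothesis.Theorems.LacunarySymmetroidMatrixDescartesCensusDiagonalEndsGauge
import Summits.ValiantsHypothesis.ValiantsHypothesis.Theorems.LacunarySymmetroidMatrixDescartesDefiniteWitness

/-!
# `WeakLifting`, line (B) `tower_graft` — calibration: the DEFINITE two-sided word exceeds `2m` ON A TOWER (`m = 2`, four letters);
# the Cameron–Psarrakos bound `z₊ ≤ n·α` fails on a tower support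

Crux `stmt-ValiantsHypothesis-19561` (`Theses.KPlusLogSqLaw.WeakLifting`), restricted sub-case of the line
`Cruxes/WeakLifting/Lines/tower_graft.lean` (tower supports).  Companion of `…TowerGraftTowerTwoSidedWitness` (`T₂₄`:
INDEFINITE pivot, `Z₊ ≥ 6 = 3m` on the 2-tower `(0,1,3,7)`) and of the off-tower definite calibration
`…LacunarySymmetroidMatrixDescartesDefiniteWitness` (`not_definiteLaw_two`: `J ≺ 0`, `Pₖ ≻ 0` on `(0,6,7,8,15)`, five letters,
`Z₊ ≥ 6 > 2m` — the `n = 2`, `α = 2` counterexample to the Cameron–Psarrakos conjecture).  Asked by the line's critic (crit-6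
READ #96 (C), price r2(ii): «definite word on a tower, in `not_definiteLaw_two`'s currency, PSD letters ε-bumped to PD»).

This file: on the TOWER support `(0, 1, 8, 64)` (`7·x < y` for all exponents `x < y`, in particular a 2-tower) the `2 × 2` pencil
`T(X) = X¹ • J + X⁰ • C₀ + X⁸ • C₈ + X⁶⁴ • C₆₄` with POSITIVE DEFINITE `Cₖ = 10⁶ • (uₖuₖᵀ + u'ₖu'ₖᵀ) + 1`,
`u = ((33,-39), (5,111), (0,55))`, `u' = ((0,-4), (0,72), (0,0))` at the exponents `(0, 8, 64)`, and NEGATIVE DEFINITE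
pivot `J = 10⁶ • [[-1015, 2199], [2199, -4773]]` (`J₀₀ < 0 < det J`) at the exponent `1` — the word `PD · ND · PD · PD`, coefficient sign
sequence `(+, −, +, +)`, `α = 2` alternations, `n·α = 4` — has `det T` alternating in sign at the seven rational points
`1/64 < 1/2 < 7/8 < 1 < 9/8 < 5/4 < 5` (`+,−,+,−,+,−,+`), hence `Z₊ ≥ 6 > 4 = 2m = n·α` (`six_le_card_posRoots_TD₂`,
`not_towerDefiniteLaw_two`, `cameronPsarrakos_counterexample_tower`).  So the tower hypothesis does not rescue the DEFINITE rung
either, already with FOUR letters (the off-tower tree witness uses five), and the Cameron–Psarrakos bound fails on tower supports.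
Provenance: compute note `liftp3-f25-stratum` v2 (j319816) of the cell `pub-symmetroid`, task `ratio-K4-rho8-0_1_8_64-p1-Z6`
(exact rational certificate there; pivot found negative definite), integerised in-seat at scale `128` (PSD factors) / `128²`
(pivot), then every letter scaled by `10⁶` and the PSD letters bumped by `+1` (identity) to make them definite; the seven signs
re-verified in exact arithmetic before typing.  Harmless to `TowerB`; a calibration datum inside every registered stub's slack.

[cite: CameronPsarrakos2019, display (6), §3, §5 — the conjectured bound `z₊(P) ≤ n·α(P)` for self-adjoint matrix polynomials
with definite-or-null coefficients; here refuted on a tower support]  Elementary; the sign pattern is a `norm_num` certificate.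
-/

-- `Summit.ValiantsHypothesis.ValiantsHypothesis.…` repeats a component by the D-0017 layout
-- (single-conjunct summit), which the `dupNamespace` linter flags; the name is mandated.
set_option linter.dupNamespace false

namespace Summit.ValiantsHypothesis.ValiantsHypothesis.Theorems.KPlusLogSqLaw.TowerGraft

open Summit.ValiantsHypothesis.ValiantsHypothesis.Theorems.SymmetroidDescartes
  (le_card_posRoots_of_alternating)
open Summit.ValiantsHypothesis.ValiantsHypothesis.Theorems.LacunarySymmetroidMatrixDescartes (StubReverse.eval_det_pencil)
open Summit.ValiantsHypothesis.ValiantsHypothesis.Theorems.LacunarySymmetroidMatrixDescartes.Census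
  (neg_posDef_of_det_pos_of_apply_neg)
open Summit.ValiantsHypothesis.ValiantsHypothesis.Theorems.LacunarySymmetroidMatrixDescartes.DefiniteWitness
  (posSemidef_vecMulVec_self)
open scoped BigOperators Matrix
open Polynomial

namespace TowerDefiniteWitness

/-- the vectors `uₖ` of the PSD parts `uₖuₖᵀ + u'ₖu'ₖᵀ` of the definite letters -/
def uD₂ : Fin 3 → Fin 2 → ℝ := ![![33, -39], ![5, 111], ![0, 55]]

/-- the vectors `u'ₖ = (0, ·)` -/
def u'D₂ : Fin 3 → Fin 2 → ℝ := ![![0, -4], ![0, 72], ![0, 0]]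

/-- the POSITIVE DEFINITE letters `Cₖ = 10⁶ • (uₖuₖᵀ + u'ₖu'ₖᵀ) + 1` -/
def CD₂ (k : Fin 3) : Matrix (Fin 2) (Fin 2) ℝ :=
  (1000000 : ℝ) • (Matrix.vecMulVec (uD₂ k) (uD₂ k) + Matrix.vecMulVec (u'D₂ k) (u'D₂ k)) + 1

/-- their exponents `(0, 8, 64)` -/
def dD₂ : Fin 3 → ℕ := ![0, 8, 64]

/-- the pivot exponent `e = 1` -/
def eD₂ : ℕ := 1

/-- the NEGATIVE DEFINITE pivot letter `J = 10⁶ • [[-1015, 2199], [2199, -4773]]` -/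
def JD₂ : Matrix (Fin 2) (Fin 2) ℝ := !![-1015000000, 2199000000; 2199000000, -4773000000]

/-- the witness pencil `X^1 • J + ∑ₖ X^{dₖ} • Cₖ` (the `stub_twoSided` / `not_definiteLaw_two` currency) -/
noncomputable def TD₂ : Matrix (Fin 2) (Fin 2) ℝ[X] :=
  ((X : ℝ[X]) ^ eD₂) • JD₂.map Polynomial.C + ∑ k, ((X : ℝ[X]) ^ dD₂ k) • (CD₂ k).map Polynomial.C

/-- every `Cₖ` is positive definite (`PSD + 1`; `DefiniteWitness.posSemidef_vecMulVec_self` of the off-tower file) -/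
theorem CD₂_posDef (k : Fin 3) : (CD₂ k).PosDef :=
  Matrix.PosDef.posSemidef_add
    (((posSemidef_vecMulVec_self (uD₂ k)).add (posSemidef_vecMulVec_self (u'D₂ k))).smul
      (by norm_num : (0 : ℝ) ≤ 1000000)) Matrix.PosDef.one

/-- `J` is symmetric -/
theorem JD₂_isSymm : JD₂.IsSymm := by
  unfold Matrix.IsSymm JD₂
  ext i j
  fin_cases i <;> fin_cases j <;> simp

/-- `J` is negative definite: `J₀₀ < 0 < det J` (`det J = 8994000000000000`) -/
theorem neg_JD₂_posDef : (-JD₂).PosDef := by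
  refine neg_posDef_of_det_pos_of_apply_neg JD₂ JD₂_isSymm ?_ ?_
  · simp [JD₂, Matrix.det_fin_two]; norm_num
  · simp [JD₂]

/-- the witness is two-sided: definite exponents on both sides of the pivot -/
theorem twoSidedD₂ : (∃ k, dD₂ k < eD₂) ∧ (∃ k, eD₂ < dD₂ k) :=
  ⟨⟨0, by simp [dD₂, eD₂]⟩, ⟨2, by simp [dD₂, eD₂]⟩⟩

/-- the support `{e} ∪ {dₖ}` = `(0, 1, 8, 64)` is a 2-TOWER (`2·x < y` for all exponents `x < y`; `TowerGraftLine.IsTower 2` for the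
sorted exponent vector), stated pairwise -/
theorem towerD₂ : (∀ k, dD₂ k < eD₂ → 2 * dD₂ k < eD₂) ∧ (∀ k, eD₂ < dD₂ k → 2 * eD₂ < dD₂ k) ∧
    (∀ k k', dD₂ k < dD₂ k' → 2 * dD₂ k < dD₂ k') := by
  refine ⟨?_, ?_, ?_⟩
  · intro k; fin_cases k <;> simp [dD₂, eD₂]
  · intro k; fin_cases k <;> simp [dD₂, eD₂]
  · intro k k'; fin_cases k <;> fin_cases k' <;> simp [dD₂]

/-- … indeed a 7-TOWER (`7·x < y`): much steeper than the line needs at `m = 2` -/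
theorem tower7D₂ : (∀ k, dD₂ k < eD₂ → 7 * dD₂ k < eD₂) ∧ (∀ k, eD₂ < dD₂ k → 7 * eD₂ < dD₂ k) ∧
    (∀ k k', dD₂ k < dD₂ k' → 7 * dD₂ k < dD₂ k') := by
  refine ⟨?_, ?_, ?_⟩
  · intro k; fin_cases k <;> simp [dD₂, eD₂]
  · intro k; fin_cases k <;> simp [dD₂, eD₂]
  · intro k k'; fin_cases k <;> fin_cases k' <;> simp [dD₂]

/-- `det T(t)` in closed form -/
theorem eval_det_TD₂ (t : ℝ) :
    (TD₂.det).eval t =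
      (1089000001 - 1015000000 * t + 25000001 * t ^ 8 + 1 * t ^ 64) *
          (1537000001 - 4773000000 * t + 17505000001 * t ^ 8 + 3025000001 * t ^ 64) -
        (-1287000000 + 2199000000 * t + 555000000 * t ^ 8) ^ 2 := by
  unfold TD₂
  rw [StubReverse.eval_det_pencil]
  simp [Matrix.det_fin_two, Fin.sum_univ_three, CD₂, uD₂, u'D₂, JD₂, dD₂, eD₂]
  ring

/-- seven positive test points -/
noncomputable def τD₂ : Fin 7 → ℝ := ![1/64, 1/2, 7/8, 1, 9/8, 5/4, 5]

/-- the test points increase -/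
theorem τD₂_strictMono : StrictMono τD₂ := by
  refine Fin.strictMono_iff_lt_succ.2 fun j => ?_
  fin_cases j <;> simp [τD₂] <;> norm_num

/-- the test points are positive -/
theorem τD₂_pos (j : Fin 7) : 0 < τD₂ j := by
  fin_cases j <;> simp [τD₂]

/-- `det T` alternates in sign along the test points (signs `+,−,+,−,+,−,+`; `norm_num` certificate) -/
theorem altD₂ (j : Fin 6) :
    (TD₂.det).eval (τD₂ j.castSucc) * (TD₂.det).eval (τD₂ j.succ) < 0 := by
  fin_cases j <;> simp only [eval_det_TD₂, τD₂] <;> simp <;> norm_num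

/-- **`Z₊ ≥ 6`** for the definite two-sided `2 × 2` witness on the tower `(0, 1, 8, 64)`. -/
theorem six_le_card_posRoots_TD₂ :
    6 ≤ (TD₂.det.roots.toFinset.filter (fun t => 0 < t)).card :=
  le_card_posRoots_of_alternating _ 6 τD₂ τD₂_strictMono τD₂_pos altD₂

end TowerDefiniteWitness

open TowerDefiniteWitness

/-- **The definite rung is false ON TOWERS at `m = 2`, already with four letters.**  It is NOT true that every two-sided `2 × 2`
pencil `X^e • J + ∑ₖ X^{dₖ} • Pₖ` with `J` NEGATIVE DEFINITE and the three `Pₖ` POSITIVE DEFINITE whose exponent set is a 2-tower has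
at most `2 · 2` distinct positive zeros of its determinant: the witness `TD₂` has at least `6`.  (`not_definiteLaw_two`'s currency plus
the tower hypotheses of line (B), one letter fewer.) -/
theorem not_towerDefiniteLaw_two : ¬ ∀ (e : ℕ) (d : Fin 3 → ℕ) (J : Matrix (Fin 2) (Fin 2) ℝ)
    (P : Fin 3 → Matrix (Fin 2) (Fin 2) ℝ), (-J).PosDef → (∀ k, (P k).PosDef) →
    (∀ k, d k < e → 2 * d k < e) → (∀ k, e < d k → 2 * e < d k) → (∀ k k', d k < d k' → 2 * d k < d k') →
    ((Matrix.det (((Polynomial.X : Polynomial ℝ) ^ e) • J.map Polynomial.C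
        + ∑ k, ((Polynomial.X : Polynomial ℝ) ^ d k) • (P k).map Polynomial.C)).roots.toFinset.filter
          (fun t => 0 < t)).card ≤ 2 * 2 := by
  intro h
  have h6 := six_le_card_posRoots_TD₂.trans
    (h eD₂ dD₂ JD₂ CD₂ neg_JD₂_posDef CD₂_posDef towerD₂.1 towerD₂.2.1 towerD₂.2.2)
  omega

/-- **Counterexample to the Cameron–Psarrakos bound on a TOWER support** [Oper. Matrices 13 (2019), display (6):
`z₊(P) ≤ n·α(P)` conjectured for self-adjoint matrix polynomials with definite-or-null coefficients].  The `2 × 2` real symmetric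
matrix polynomial `C₀ + t C₁ + t⁸ C₈ + t⁶⁴ C₆₄` below (support `(0,1,8,64)`, a 7-tower) has `C₀, C₈, C₆₄ ≻ 0`, `C₁ ≺ 0` — `α = 2`,
`n·α = 4` — yet at least `6 > 4` distinct positive real eigenvalues. -/
theorem cameronPsarrakos_counterexample_tower :
    ∃ (C₀ C₁ C₈ C₆₄ : Matrix (Fin 2) (Fin 2) ℝ),
      C₀.PosDef ∧ (-C₁).PosDef ∧ C₈.PosDef ∧ C₆₄.PosDef ∧
        2 * 2 < ((Matrix.det (C₀.map Polynomial.C + ((X : ℝ[X]) ^ 1) • C₁.map Polynomial.C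
            + ((X : ℝ[X]) ^ 8) • C₈.map Polynomial.C + ((X : ℝ[X]) ^ 64) • C₆₄.map Polynomial.C)).roots.toFinset.filter
              (fun t => 0 < t)).card := by
  refine ⟨CD₂ 0, JD₂, CD₂ 1, CD₂ 2, CD₂_posDef 0, neg_JD₂_posDef, CD₂_posDef 1, CD₂_posDef 2, ?_⟩
  have hP : (CD₂ 0).map Polynomial.C + ((X : ℝ[X]) ^ 1) • JD₂.map Polynomial.C
      + ((X : ℝ[X]) ^ 8) • (CD₂ 1).map Polynomial.C + ((X : ℝ[X]) ^ 64) • (CD₂ 2).map Polynomial.C = TD₂ := by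
    simp only [TD₂, Fin.sum_univ_three, dD₂, eD₂, Matrix.cons_val_zero, Matrix.cons_val_one, Matrix.cons_val_two,
      Matrix.head_cons, Matrix.tail_cons, pow_zero, one_smul]
    abel
  rw [hP]
  have h6 := six_le_card_posRoots_TD₂
  omega

/-- Existential form in the line's vocabulary: a NEGATIVE DEFINITE pivot, POSITIVE DEFINITE letters on both sides, a 2-tower support,
and MORE than `2 · card ι` positive zeros. -/
theorem exists_tower_definite_gt_two_mul_card_two :
    ∃ (e : ℕ) (d : Fin 3 → ℕ) (J : Matrix (Fin 2) (Fin 2) ℝ) (P : Fin 3 → Matrix (Fin 2) (Fin 2) ℝ),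
      (-J).PosDef ∧ (∀ k, (P k).PosDef) ∧ (∃ k, d k < e) ∧ (∃ k, e < d k) ∧
        (∀ k, d k < e → 2 * d k < e) ∧ (∀ k, e < d k → 2 * e < d k) ∧ (∀ k k', d k < d k' → 2 * d k < d k') ∧
        2 * Fintype.card (Fin 2) <
          ((Matrix.det (((X : ℝ[X]) ^ e) • J.map Polynomial.C
              + ∑ k, ((X : ℝ[X]) ^ d k) • (P k).map Polynomial.C)).roots.toFinset.filter
                (fun t => 0 < t)).card :=
  ⟨eD₂, dD₂, JD₂, CD₂, neg_JD₂_posDef, CD₂_posDef, twoSidedD₂.1, twoSidedD₂.2, towerD₂.1, towerD₂.2.1, towerD₂.2.2, by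
    have h6 := six_le_card_posRoots_TD₂
    simp only [Fintype.card_fin]
    exact lt_of_lt_of_le (by norm_num) h6⟩

end Summit.ValiantsHypothesis.ValiantsHypothesis.Theorems.KPlusLogSqLaw.TowerGraft
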